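import Summits.CriticalPhenomena.CardyFormulaZ2.Theses.CardyMagicRigidity
import Literature.Probability.RandomPlanarGeometry.LoopConfigurationsBlind
import Literature.Probability.Percolation.FullPlaneCNL
import Literature.Probability.Percolation.PercolationEvents
import Literature.Probability.Percolation.SitePaths
import Literature.Probability.Percolation.Crossings
import HarnessLib

/-!
# Vocabulary of line `pinch-resampling` (v2) for crux `NestingRigidity` (stmt-CriticalPhenomena-4835)

Route `CardyMagicRigidity` (sub-problem `CriticalPhenomena/CardyFormulaZ2`), crux
`Summit.CriticalPhenomena.CardyFormulaZ2.Theses.CardyMagicRigidity.NestingRigidity ≡ MagicFormulaZ2 → MagicFormulaT →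
LoopLimitZ2EqT` (`Iff.rfl`).  This is the **definitions module** of the checked skeleton
`Cruxes/NestingRigidity/Lines/pinch_resampling.lean` v2 (crux-strategist p1, 2026-08-17; `ledger skeleton check` OK dc524c5c,
registered stubs `stub_blindRigidity`, `stub_fourArmCouplingT`, `stub_fourArmCouplingZ2`, `stub_tomographicTransfer`; lead seat c5-0).
It carries, verbatim and sorry-free, the skeleton's §0 VOCABULARY — annulus crossings in cluster form (`innerLayer`, `outerLayer`,
`IsCrossing`, `TwoCrossingClusters`, `HookedUp`), the site-`𝕋` objects (`tBall`, `tColourGraph`, `TFourArms`, `TPinch`, `THook`,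
`tInt`) and the stub statement `FourArmCouplingT`, the bond-`ℤ²` objects (`zNorm`, `zBall`, `zDualBall`, the Φ-symmetric medial gadget
`zMedBlock` / `zMedDualBlock`, `ZFourArms`, `ZPinch`, `ZHook`, `zExtEdges`, `zIntEdges`) and the stub statement `FourArmCouplingZ2` —
and §1 the blind target `LoopLimitZ2Blind` (child `BlindRigidity` of the certified split, `Cruxes/NestingRigidity/StrategistSplit.lean`),
so that the stub helper files `Theorems/CardyMagicRigidityNestingRigidity<StubName>.lean` (`--supports stmt-CriticalPhenomena-4835`) and
the closing skeleton share ONE copy of every object.  §2 records, sorry-free, that `LoopLimitZ2Blind` is literally the convergence to `0`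
of the Literature blind coupling distance `LoopConfig.blindLawEDist` between the two lattice laws (`loopLimitZ2Blind_iff`, `Iff.rfl`),
that it is implied by the target (`loopLimitZ2Blind_of_loopLimitZ2EqT`, via `blindLawEDist_le_cnLawEDist`), and the pure-logic
composition of the four stub STATEMENTS into the crux (`nestingRigidity_of_stubs`, the anchor of this module on the crux item).

Nothing in this file is asserted: every `def … : Prop` is a statement to be proved by a registered stub (`FourArmCouplingT`,
`FourArmCouplingZ2`, `LoopLimitZ2Blind` as the conclusion of `stub_blindRigidity`) or a predicate used to state them.

WHY THESE OBJECTS (line card `Cruxes/NestingRigidity/Lines/pinch-resampling.md` v2).  Route gap G4 (routing blindness, p132831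
`not_tame_rigidity`, p133027 `exists_tame_laws_windEq_le_cnLawEDist`) killed the transfer step of the three earlier lines: every nesting
functional is a function of the blind data (trace, winding interior, type), which does not determine the unbased loop at an interleaved
pinch pair, while `d_CN` sees the routing.  The line factors the crux as BLIND RIGIDITY (`MagicFormulaZ2 → MagicFormulaT →
LoopLimitZ2Blind`, the residual wall) ∘ ROUTING TRANSFER, and cuts the routing half into two single-lattice LOCALITY inputs — the
four-arm coupling property in total variation (Garban–Pete–Schramm, arXiv:1008.1378, Prop. 11 type) on `𝕋` and on `ℤ²`, stated below for
the sub-event "exactly two open and two closed crossing clusters" of an annulus around a small gadget — and one lattice-free transfer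
(`FourArmCouplingT → FourArmCouplingZ2 → LoopLimitZ2Blind → LoopLimitZ2EqT`, neck tomography).
-/

noncomputable section

namespace Summit.CriticalPhenomena.CardyFormulaZ2.Cruxes.NestingRigidity.PinchResampling

open Summit.CriticalPhenomena.CardyFormulaZ2.Theses.CardyMagicRigidity
open MeasureTheory Literature.Probability.Percolation Literature.Probability.LatticeModels
  Literature.Probability.RandomPlanarGeometry

/-! ## §0 Vocabulary -/

section Annuli

variable {V : Type*}

/-- The inner layer of the annulus `O ∖ I`: its vertices `G`-adjacent to the hole `I`. -/
def innerLayer (G : SimpleGraph V) (I O : Set V) : Set V := {v | v ∈ O \ I ∧ ∃ w ∈ I, G.Adj v w}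

/-- The outer layer of the annulus `O ∖ I`: its vertices `G`-adjacent to the outside of `O`. -/
def outerLayer (G : SimpleGraph V) (I O : Set V) : Set V := {v | v ∈ O \ I ∧ ∃ w ∉ O, G.Adj v w}

/-- `v` starts a crossing of the annulus `O ∖ I` in the graph `H` (the open graph of one colour), the layers being
read in the underlying lattice graph `G`: `v` lies on the inner layer and is joined to the outer layer by an `H`-path of
vertices of the annulus (`PathIn H (O ∖ I)`). -/
def IsCrossing (G H : SimpleGraph V) (I O : Set V) (v : V) : Prop :=
  v ∈ innerLayer G I O ∧ ∃ w ∈ outerLayer G I O, PathIn H (O \ I) v w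

/-- **Exactly two crossing clusters** of the annulus `O ∖ I` in the graph `H` ("cluster form" of two arms of one
colour, cf. `Literature.Probability.Percolation.altFourArm`): there are two crossings not joined by an `H`-path of the
annulus, and among any three crossings two are joined. -/
def TwoCrossingClusters (G H : SimpleGraph V) (I O : Set V) : Prop :=
  (∃ v₁ v₂, IsCrossing G H I O v₁ ∧ IsCrossing G H I O v₂ ∧ ¬ PathIn H (O \ I) v₁ v₂) ∧
    ∀ v₁ v₂ v₃, IsCrossing G H I O v₁ → IsCrossing G H I O v₂ → IsCrossing G H I O v₃ →
      PathIn H (O \ I) v₁ v₂ ∨ PathIn H (O \ I) v₁ v₃ ∨ PathIn H (O \ I) v₂ v₃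

/-- **Hook-up**: all `H`-crossings of the annulus `O ∖ I` are joined by an `H`-path of the big region `O` (through the
hole).  Under `TwoCrossingClusters` for both colours exactly one colour is hooked up (planar duality in the disc). -/
def HookedUp (G H : SimpleGraph V) (I O : Set V) : Prop :=
  ∀ v w, IsCrossing G H I O v → IsCrossing G H I O w → PathIn H O v w

end Annuli

section SiteT

/-! ### Site percolation on `𝕋` (`triGraph` on `Site 2`, hexagonal norm `triNorm`) -/

/-- The hexagonal ball `Λ_n(x) = {v : |v - x|_𝕋 ≤ n}`. -/
def tBall (x : Site 2) (n : ℕ) : Set (Site 2) := {v | triNorm (v - x) ≤ n}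

/-- The open (`c = true`) resp. closed (`c = false`) subgraph of `𝕋` in the site configuration `ω`. -/
def tColourGraph (ω : SiteConfig (Site 2)) (c : Bool) : SimpleGraph (Site 2) :=
  siteOpenGraph triGraph {u | (u ∈ ω) = c}

/-- **Four alternating arms in cluster form** across the annulus `O ∖ I` of `𝕋`: exactly two open and exactly two
closed crossing clusters (polychromatic, alternating, no fifth crossing cluster). -/
def TFourArms (ω : SiteConfig (Site 2)) (I O : Set (Site 2)) : Prop :=
  TwoCrossingClusters triGraph (tColourGraph ω true) I O ∧ TwoCrossingClusters triGraph (tColourGraph ω false) I O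

/-- **The pinch event** `Pinch_𝕋(x, y; m, n)`: four alternating arms from the small ball `Λ_m(y)` (`y` near `x`) all
the way to the boundary of the pinch ball's collar `Λ_{2n}(x)` — two macroscopic interface strands enter `Λ_{2n}(x)`
and come within `≍ m` of each other at `y`. -/
def TPinch (x y : Site 2) (m n : ℕ) : Set (SiteConfig (Site 2)) :=
  {ω | TFourArms ω (tBall y m) (tBall x (2 * n))}

/-- **The open hook-up** at the pinch: the two open arms are joined by an open path of `Λ_{2n}(x)` (necessarily through
the hole `Λ_m(y)`); its complement within `TPinch` is the closed hook-up. -/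
def THook (x y : Site 2) (m n : ℕ) : Set (SiteConfig (Site 2)) :=
  {ω | HookedUp triGraph (tColourGraph ω true) (tBall y m) (tBall x (2 * n))}

/-- The sites of the ball `Λ_s(y)` (interior coordinates) — interior events are `DeterminedBy · (tBall y s)`; exterior
events of `Λ_n(x)` are `DeterminedBy · (tBall x n)ᶜ`. -/
abbrev tInt (y : Site 2) (s : ℕ) : Set (Site 2) := tBall y s

/-- **`FourArmCouplingT` — exterior forgetting for site percolation on `𝕋` (stub S2), total-variation form.**  For every
`b > 0` there is a scale ratio `M` such that for all centres `x`, inner centres `y`, gadget sizes `m ≤ s` and radii `n` with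
`Λ_s(y)` inside `Λ_{n/2}(x)` and `n ≥ M s`: for any two EXTERIOR events `F, F'` (determined off `Λ_n(x)`) and every INTERIOR
event `E` (determined inside `Λ_s(y)`), conditionally on the pinch event (four clean alternating arms from `Λ_m(y)` to
`∂Λ_{2n}(x)`) the probability of `E` is the same under `F` and under `F'` up to `b` — written cross-multiplied:
`|P(E∩Pinch∩F)·P(Pinch∩F') − P(E∩Pinch∩F')·P(Pinch∩F)| ≤ b·P(Pinch∩F)·P(Pinch∩F')`.
(GPS arXiv:1008.1378 Prop. 11, "coupling property": explore the four interfaces inward, separate (Nolin), RSW-glue, couple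
identically below the gluing scale; error `(s/n)^c`.) -/
def FourArmCouplingT : Prop :=
  ∀ b : ℝ, 0 < b → ∃ M : ℕ, ∀ (x y : Site 2) (m s n : ℕ), m ≤ s → 2 * triNorm (y - x) + 2 * s ≤ n → M * s ≤ n →
    ∀ F F' : Set (SiteConfig (Site 2)), MeasurableSet F → MeasurableSet F' →
      DeterminedBy F (tBall x n)ᶜ → DeterminedBy F' (tBall x n)ᶜ →
    ∀ E : Set (SiteConfig (Site 2)), MeasurableSet E → DeterminedBy E (tInt y s) →
      |(triSitePercolation half).real (E ∩ TPinch x y m n ∩ F) * (triSitePercolation half).real (TPinch x y m n ∩ F') -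
          (triSitePercolation half).real (E ∩ TPinch x y m n ∩ F') * (triSitePercolation half).real (TPinch x y m n ∩ F)| ≤
        b * (triSitePercolation half).real (TPinch x y m n ∩ F) * (triSitePercolation half).real (TPinch x y m n ∩ F')

end SiteT

section BondZ2

/-! ### Bond percolation on `ℤ²` (`zdGraph 2`, primal arms and dual arms, `dualConfig`) -/

/-- The sup norm on `ℤ²`. -/
def zNorm (v : Site 2) : ℤ := max |v 0| |v 1|

/-- The primal box `Λ_n(x) = {v : |v - x|_∞ ≤ n}`. -/
def zBall (x : Site 2) (n : ℕ) : Set (Site 2) := {v | zNorm (v - x) ≤ n}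

/-- The dual box of radius `n + ½` about `x`: dual vertices are indexed by lower-left corners (`dualEdge`: the dual
vertex `v` sits at `v + (½, ½)`), so this is `{v : |v + ½ − x|_∞ ≤ n + ½}`; every dual edge between two dual vertices
outside it crosses a primal edge with both endpoints outside `Λ_n(x)`. -/
def zDualBall (x : Site 2) (n : ℕ) : Set (Site 2) := {v | zNorm (2 • (v - x) + 1) ≤ 2 * n + 1}

/-- **The Φ-symmetric ("medial") gadget, primal half**: the vertex block `y + [-m, m+1] × [-m, m]`.  For `m = 0` it is the
single edge `{y, y + e₀}`. -/
def zMedBlock (y : Site 2) (m : ℕ) : Set (Site 2) :=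
  {v | -(m : ℤ) ≤ v 0 - y 0 ∧ v 0 - y 0 ≤ m + 1 ∧ |v 1 - y 1| ≤ m}

/-- **The Φ-symmetric gadget, dual half**: the dual-vertex block `y + [-m, m] × [-m-1, m]` (lower-left-corner indexing), i.e.
the points `y + [½-m, m+½] × [-m-½, m+½]` — the image of `zMedBlock y m` under the quarter turn `ρ` about the MEDIAL vertex
`y + (½, 0)`, which maps `ℤ²` onto the dual lattice; `ρ²` (the point reflection in `y + (½,0)`) fixes both blocks.  Hence
`Φ := ρ_* ∘ (pass to the dual) ∘ (complement)` preserves `P_{1/2}`, maps the four-arm event of the gadget to itself and SWAPS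
the two hook-ups.  For `m = 0` the block is the dual edge crossing `{y, y + e₀}`. -/
def zMedDualBlock (y : Site 2) (m : ℕ) : Set (Site 2) :=
  {v | |v 0 - y 0| ≤ m ∧ -(m : ℤ) - 1 ≤ v 1 - y 1 ∧ v 1 - y 1 ≤ m}

/-- **Four alternating arms in cluster form on `ℤ²`**: exactly two primal-open crossing clusters of the primal annulus
`Op ∖ Ip` and exactly two dual-open crossing clusters of the dual annulus `Od ∖ Id`. -/
def ZFourArms (ω : BondConfig (Site 2)) (Ip Op Id Od : Set (Site 2)) : Prop :=
  TwoCrossingClusters (zdGraph 2) (openGraph ω) Ip Op ∧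
    TwoCrossingClusters (zdGraph 2) (openGraph (dualConfig ω)) Id Od

/-- **The pinch event on `ℤ²`** `Pinch_ℤ²(x, y; m, n)` (v2): four clean alternating primal/dual arms from the Φ-symmetric
gadget of size `m` at `y` to the boundary of the collar boxes `Λ_{2n}(x)` (primal) / radius `2n + ½` (dual). -/
def ZPinch (x y : Site 2) (m n : ℕ) : Set (BondConfig (Site 2)) :=
  {ω | ZFourArms ω (zMedBlock y m) (zBall x (2 * n)) (zMedDualBlock y m) (zDualBall x (2 * n))}

/-- **The primal hook-up on `ℤ²`**: the two primal-open arms are joined by an open path of `Λ_{2n}(x)` (through the gadget). -/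
def ZHook (x y : Site 2) (m n : ℕ) : Set (BondConfig (Site 2)) :=
  {ω | HookedUp (zdGraph 2) (openGraph ω) (zMedBlock y m) (zBall x (2 * n))}

/-- The exterior edges of the box `Λ_n(x)`: pairs with no endpoint in the box (the exterior σ-field). -/
def zExtEdges (x : Site 2) (n : ℕ) : Set (Sym2 (Site 2)) := {e | ∀ v ∈ e, v ∉ zBall x n}

/-- The interior edges of the box `Λ_s(y)`: pairs with both endpoints in the box. -/
def zIntEdges (y : Site 2) (s : ℕ) : Set (Sym2 (Site 2)) := {e | ∀ v ∈ e, v ∈ zBall y s}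

/-- **`FourArmCouplingZ2` — exterior forgetting for bond percolation on `ℤ²` (stub S3), total-variation form**, as
`FourArmCouplingT` with primal/dual arms from the Φ-symmetric gadget, exterior events determined by the edges off `Λ_n(x)` and
interior events by the edges inside `Λ_s(y)`.  (The 4-arm coupling property on `ℤ²` is asserted in GPS arXiv:1008.1378 §1 p. 10
— "all ingredients remain valid that do not use conformal invariance"; arm separation on `ℤ²`: Kesten 1987, Damron–Sapozhnikov
arXiv:0903.4496; the tree has `Zd*FourArm*`.) -/
def FourArmCouplingZ2 : Prop :=
  ∀ b : ℝ, 0 < b → ∃ M : ℕ, ∀ (x y : Site 2) (m s n : ℕ), m ≤ s → 2 * zNorm (y - x) + 2 * s ≤ n → M * s ≤ n →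
    ∀ F F' : Set (BondConfig (Site 2)), MeasurableSet F → MeasurableSet F' →
      DeterminedBy F (zExtEdges x n) → DeterminedBy F' (zExtEdges x n) →
    ∀ E : Set (BondConfig (Site 2)), MeasurableSet E → DeterminedBy E (zIntEdges y s) →
      |(bondPercolation (zdGraph 2) half).real (E ∩ ZPinch x y m n ∩ F) *
            (bondPercolation (zdGraph 2) half).real (ZPinch x y m n ∩ F') -
          (bondPercolation (zdGraph 2) half).real (E ∩ ZPinch x y m n ∩ F') *
            (bondPercolation (zdGraph 2) half).real (ZPinch x y m n ∩ F)| ≤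
        b * (bondPercolation (zdGraph 2) half).real (ZPinch x y m n ∩ F) *
          (bondPercolation (zdGraph 2) half).real (ZPinch x y m n ∩ F')

end BondZ2

/-! ## §1 The blind target (child `BlindRigidity` of the certified split; statement shared with `Lines/fair_coin_routing.lean`) -/

/-- **`LoopLimitZ2Blind`** — blind loop universality `ℤ² ~ 𝕋`: `LoopLimitZ2EqT` with DKKMO's `d(γ,γ') ≤ ε` replaced by
"Hausdorff distance of the traces `≤ ε` and winding interiors `{W ≠ 0}` equal off the `ε`-neighbourhood of the traces"
(literally the term of `FairCoinRouting.LoopLimitZ2Blind`, `Cruxes/NestingRigidity/StrategistSplit.lean`). -/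
def LoopLimitZ2Blind : Prop :=
  Filter.Tendsto (fun δ : ℝ ↦ ⨅ (ε : ℝ) (_ : 0 < ε) (P : MeasureTheory.Measure (Literature.Probability.Percolation.BondConfig (Literature.Probability.LatticeModels.Site 2) × Literature.Probability.Percolation.SiteConfig (Literature.Probability.LatticeModels.Site 2))) (_ : P.map Prod.fst = Literature.Probability.Percolation.bondPercolation (Literature.Probability.LatticeModels.zdGraph 2) Literature.Probability.Percolation.half) (_ : P.map Prod.snd = Literature.Probability.LatticeModels.triSitePercolation Literature.Probability.Percolation.half) (_ : P {p | ¬ (∀ i : Fin 2, (∀ u ∈ (Literature.Probability.Percolation.bondLoopConfig δ 0 p.1).F i, u.range ⊆ Metric.ball (0 : ℂ) (1 / ε) → ∃ u' ∈ (⟨fun i ↦ {u : Literature.Probability.RandomPlanarGeometry.UnbasedLoop ℂ | ∃ (v : Literature.Probability.LatticeModels.HexVertex) (γ : Literature.Probability.LatticeModels.hexGraph.Walk v v), Literature.Probability.Percolation.IsSiteInterfaceLoop p.2 γ ∧ (i = 1 ↔ 0 < Literature.Probability.Percolation.shoelace (γ.support.map Literature.Probability.LatticeModels.hexCenter)) ∧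 u = Literature.Probability.RandomPlanarGeometry.UnbasedLoop.mk (Literature.Probability.RandomPlanarGeometry.BasedLoop.mk (Literature.Probability.Percolation.siteLoopCurve δ γ) (Literature.Probability.Percolation.isLoop_siteLoopCurve δ γ))}⟩ : Literature.Probability.RandomPlanarGeometry.LoopConfig ℂ).F i, Metric.hausdorffEDist u.range u'.range ≤ ENNReal.ofReal ε ∧ symmDiff {z : ℂ | u.wind z ≠ 0} {z : ℂ | u'.wind z ≠ 0} ⊆ Metric.cthickening ε (u.range ∪ u'.range)) ∧ (∀ u' ∈ (⟨fun i ↦ {u : Literature.Probability.RandomPlanarGeometry.UnbasedLoop ℂ | ∃ (v : Literature.Probability.LatticeModels.HexVertex) (γ : Literature.Probability.LatticeModels.hexGraph.Walk v v), Literature.Probability.Percolation.IsSiteInterfaceLoop p.2 γ ∧ (i = 1 ↔ 0 < Literature.Probability.Percolation.shoelace (γ.support.map Literature.Probability.LatticeModels.hexCenter)) ∧ u = Literature.Probability.RandomPlanarGeometry.UnbasedLoop.mk (Literature.Probability.RandomPlanarGeometry.BasedLoop.mk (Literature.Probability.Percolation.siteLoopCurve δ γ) (Literature.Probability.Percolation.isLoop_siteLoopCurve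 δ γ))}⟩ : Literature.Probability.RandomPlanarGeometry.LoopConfig ℂ).F i, u'.range ⊆ Metric.ball (0 : ℂ) (1 / ε) → ∃ u ∈ (Literature.Probability.Percolation.bondLoopConfig δ 0 p.1).F i, Metric.hausdorffEDist u'.range u.range ≤ ENNReal.ofReal ε ∧ symmDiff {z : ℂ | u'.wind z ≠ 0} {z : ℂ | u.wind z ≠ 0} ⊆ Metric.cthickening ε (u'.range ∪ u.range)))} < ENNReal.ofReal ε), ENNReal.ofReal ε) (nhdsWithin 0 (Set.Ioi 0)) (nhds 0)

/-! ## §2 Glue (sorry-free): the blind target in Literature vocabulary, and the composition of the stubs -/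

/-- `LoopLimitZ2Blind` is, letter for letter, the convergence to `0` as `δ → 0⁺` of the Literature BLIND coupling distance
`LoopConfig.blindLawEDist` (`Literature.Probability.RandomPlanarGeometry.LoopConfigurationsBlind`) between the law of DKKMO's typed
loop representation `bondLoopConfig δ 0` of critical bond percolation on `δℤ²` and the law of the typed honeycomb interface-loop
configuration `siteLoopConfig δ` of critical site percolation on `δ𝕋` (definitional: `BlindNear`, `LoopConfig.IsBlindClose`,
`siteLoopConfig_eq`). -/
theorem loopLimitZ2Blind_iff :
    LoopLimitZ2Blind ↔ Filter.Tendsto (fun δ : ℝ ↦ LoopConfig.blindLawEDist (bondPercolation (zdGraph 2) half) (bondLoopConfig δ 0)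
      (triSitePercolation half) (siteLoopConfig δ)) (nhdsWithin 0 (Set.Ioi 0)) (nhds 0) :=
  Iff.rfl

/-- The target `LoopLimitZ2EqT` is, letter for letter, the convergence to `0` of DKKMO's coupling distance `LoopConfig.cnLawEDist`
between the same two laws (`siteLoopConfig_eq`). -/
theorem loopLimitZ2EqT_iff :
    LoopLimitZ2EqT ↔ Filter.Tendsto (fun δ : ℝ ↦ LoopConfig.cnLawEDist (bondPercolation (zdGraph 2) half) (bondLoopConfig δ 0)
      (triSitePercolation half) (siteLoopConfig δ)) (nhdsWithin 0 (Set.Ioi 0)) (nhds 0) :=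
  Iff.rfl

/-- **Soundness of the blind target**: `LoopLimitZ2EqT → LoopLimitZ2Blind` (the blind coupling distance is dominated by `d_CN` on laws,
`LoopConfig.blindLawEDist_le_cnLawEDist`; squeeze).  So `stub_blindRigidity` is implied by the crux and the routing child
`LoopLimitZ2Blind → LoopLimitZ2EqT` by the target: the split loses nothing. -/
theorem loopLimitZ2Blind_of_loopLimitZ2EqT (hX : LoopLimitZ2EqT) : LoopLimitZ2Blind := by
  rw [loopLimitZ2Blind_iff]
  rw [loopLimitZ2EqT_iff] at hX
  refine tendsto_of_tendsto_of_tendsto_of_le_of_le tendsto_const_nhds hX (fun δ ↦ bot_le) fun δ ↦ ?_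
  exact LoopConfig.blindLawEDist_le_cnLawEDist _ _ _ _

/-- **Composition of the line (pure logic)**: the four registered stub STATEMENTS of `pinch-resampling` v2 give the crux —
blind rigidity (`MagicFormulaZ2 → MagicFormulaT → LoopLimitZ2Blind`), locality on `𝕋` (`FourArmCouplingT`), locality on `ℤ²`
(`FourArmCouplingZ2`) and the tomographic transfer (`FourArmCouplingT → FourArmCouplingZ2 → LoopLimitZ2Blind → LoopLimitZ2EqT`).
This is the anchor of the module on the crux item; the closing skeleton instantiates it with the four stub theorems. -/
theorem nestingRigidity_of_stubs : (MagicFormulaZ2 → MagicFormulaT → LoopLimitZ2Blind) → FourArmCouplingT → FourArmCouplingZ2 → (FourArmCouplingT → FourArmCouplingZ2 → LoopLimitZ2Blind → LoopLimitZ2EqT) → NestingRigidity :=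
  fun h₁ h₂ h₃ h₄ hZ hT ↦ h₄ h₂ h₃ (h₁ hZ hT)

end Summit.CriticalPhenomena.CardyFormulaZ2.Cruxes.NestingRigidity.PinchResampling

end
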